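import Mathlib
import Literature.AlgebraicGeometry.Resolution.BlowupChartRsop

/-!
# The `μ₃` cones `⅓(1^a, 2^b) × 𝔸^c`: definitions (weight-`0` subalgebra, vertex generators)
(crux stmt-ResolutionOfSingularities-15640 `WildQuotients.WildQuotientResolution`, line `Sketch`;
chain w45c NEXT RUNG R-T, res-L1-w45c-idea-2's RT-LADDER v1.2 §5 «conjecture T3» (one reduced-vertex
blow-up resolves every `⅓(1^a,2^b) × 𝔸^c`), res-L1-w45c-plan-1 GO 2026-08-27T10:03:49Z with the shape
request «explicit weight-0 subalgebra compatible with `Third112`'s presentation»; [OURS · L1 W4.5c] —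
NOT a statement of any manuscript; replaces the role of no printed item. Owner res-L1-w45c-stub-2.)

For a weight `w : Fin n → ZMod 3` (weight `1` = the `a` variables, weight `2` = the `b` variables,
weight `0` = the `c` passengers; `Third112.coneWeight n a b c` is the case `(1,1,2,0,…)`):
* `ThirdCone.cone k n w` — the weight-`0` subalgebra of `k[x₁,…,x_n]` (= the invariant ring of
  `⅓(w)` when `3 ∈ kˣ`, tensor the passengers; = `(Third112.presentation …).range` for `coneWeight`
  by `Third112.mem_range_presentation_iff`, p502264);
* `ThirdCone.VIdx n w` — the index type of the VERTEX GENERATORS: triples of weight-`1` variables,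
  triples of weight-`2` variables, (weight-`1`, weight-`2`) pairs;
* `ThirdCone.vertexGen k n w : VIdx n w → cone` — the monomials `x_ix_jx_l`, `y_iy_jy_l`, `x_iy_j`;
* `ThirdCone.vertexFamily k n w : Fin (Fintype.card (VIdx n w)) → cone` — the same family
  re-indexed by `Fin _` (the format of `Literature…chartRing` / `JordanThree.isRegular_affineBlowup_of_charts`);
* `ThirdCone.vertexIdeal k n w := Ideal.span (Set.range (vertexFamily k n w))` — the REDUCED VERTEX
  ideal `𝔪_{⅓(w)} · (cone)` (it is generated by these monomials: every weight-`0` monomial touching a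
  non-passenger variable is a multiple of one of them by a weight-`0` monomial).
Theorem T3 (`ThirdCone.blowup_regular`, separate files): `affineBlowup (vertexIdeal k n w)` is
regular (and integral, proper, birational over `Spec cone` as soon as some weight is non-zero).
-/

-- single-problem summit: the doubled namespace component `ResolutionOfSingularities` is forced
set_option linter.dupNamespace false

noncomputable section

open MvPolynomial

namespace Summit.ResolutionOfSingularities.ResolutionOfSingularities.Theorems.WildQuotientResolution.ThirdCone

variable (k : Type) [Field k] (n : ℕ) (w : Fin n → ZMod 3)

/-- **The cone `⅓(w)`**: the subalgebra of `k[x₁,…,x_n]` of polynomials all of whose monomials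
`x^d` have weight `∑ dᵢ wᵢ = 0` in `ZMod 3`. [OURS · L1 W4.5c] -/
def cone : Subalgebra k (MvPolynomial (Fin n) k) where
  carrier := {f | IsWeightedHomogeneous w f 0}
  mul_mem' {f g} hf hg := by simpa using hf.mul hg
  one_mem' := isWeightedHomogeneous_one k w
  add_mem' {f g} hf hg := hf.add hg
  zero_mem' := isWeightedHomogeneous_zero k w 0
  algebraMap_mem' r := isWeightedHomogeneous_C w r

/-- Membership in the cone is weighted homogeneity of weight `0`. [OURS · L1 W4.5c] -/
theorem mem_cone_iff (f : MvPolynomial (Fin n) k) : f ∈ cone k n w ↔ IsWeightedHomogeneous w f 0 :=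
  Iff.rfl

/-- A monomial lies in the cone iff its exponent has weight `0` (or its coefficient vanishes).
[OURS · L1 W4.5c] -/
theorem monomial_mem_cone {d : Fin n →₀ ℕ} (hd : Finsupp.weight w d = 0) (r : k) :
    monomial d r ∈ cone k n w :=
  isWeightedHomogeneous_monomial w d r hd

/-- **Index type of the vertex generators**: weight-`1` triples, weight-`2` triples, mixed pairs.
[OURS · L1 W4.5c] -/
abbrev VIdx : Type :=
  ({i : Fin n // w i = 1} × {i : Fin n // w i = 1} × {i : Fin n // w i = 1}) ⊕
  ({i : Fin n // w i = 2} × {i : Fin n // w i = 2} × {i : Fin n // w i = 2}) ⊕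
  ({i : Fin n // w i = 1} × {i : Fin n // w i = 2})

/-- The exponent vector of a vertex generator. [OURS · L1 W4.5c] -/
def vertexExp : VIdx n w → (Fin n →₀ ℕ)
  | Sum.inl ⟨i, j, l⟩ => Finsupp.single i.1 1 + Finsupp.single j.1 1 + Finsupp.single l.1 1
  | Sum.inr (Sum.inl ⟨i, j, l⟩) => Finsupp.single i.1 1 + Finsupp.single j.1 1 + Finsupp.single l.1 1
  | Sum.inr (Sum.inr ⟨i, j⟩) => Finsupp.single i.1 1 + Finsupp.single j.1 1

/-- `weight w (single i 1) = w i`. [folklore] -/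
theorem weight_single_one (i : Fin n) : Finsupp.weight w (Finsupp.single i 1) = w i := by
  rw [Finsupp.weight_apply, Finsupp.sum_single_index (zero_smul ℕ (w i)), one_smul]

/-- Every vertex exponent has weight `0`: `1+1+1 = 2+2+2 = 1+2 = 0` in `ZMod 3`. [OURS · L1 W4.5c] -/
theorem weight_vertexExp (v : VIdx n w) : Finsupp.weight w (vertexExp n w v) = 0 := by
  rcases v with ⟨i, j, l⟩ | ⟨i, j, l⟩ | ⟨i, j⟩
  · rw [vertexExp, map_add, map_add, weight_single_one, weight_single_one, weight_single_one, i.2, j.2,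
      l.2]; decide
  · rw [vertexExp, map_add, map_add, weight_single_one, weight_single_one, weight_single_one, i.2, j.2,
      l.2]; decide
  · rw [vertexExp, map_add, weight_single_one, weight_single_one, i.2, j.2]; decide

/-- **The vertex generators** `x_ix_jx_l` (weights `1,1,1`), `y_iy_jy_l` (weights `2,2,2`),
`x_iy_j` (weights `1,2`), as elements of the cone. [OURS · L1 W4.5c] -/
def vertexGen (v : VIdx n w) : cone k n w :=
  ⟨monomial (vertexExp n w v) 1, monomial_mem_cone k n w (weight_vertexExp n w v) 1⟩

/-- The vertex generators re-indexed by `Fin _`. [OURS · L1 W4.5c] -/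
def vertexFamily : Fin (Fintype.card (VIdx n w)) → cone k n w :=
  vertexGen k n w ∘ (Fintype.equivFin (VIdx n w)).symm

/-- **The reduced vertex ideal** of the cone: the ideal generated by the vertex generators.
[OURS · L1 W4.5c] -/
def vertexIdeal : Ideal (cone k n w) :=
  Ideal.span (Set.range (vertexFamily k n w))

/-- `vertexFamily` and `vertexGen` have the same range. [OURS · L1 W4.5c] -/
theorem range_vertexFamily : Set.range (vertexFamily k n w) = Set.range (vertexGen k n w) :=
  EquivLike.range_comp _ _

/-- The value of a vertex generator as a polynomial. [OURS · L1 W4.5c] -/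
theorem coe_vertexGen (v : VIdx n w) :
    ((vertexGen k n w v : cone k n w) : MvPolynomial (Fin n) k) = monomial (vertexExp n w v) 1 :=
  rfl

end Summit.ResolutionOfSingularities.ResolutionOfSingularities.Theorems.WildQuotientResolution.ThirdCone

end
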